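import Literature.RingTheory.FormalGroups.UniversalFormalOModuleLawDirection
import Literature.RingTheory.FormalGroups.FormalOModuleBudCocycle
import Literature.RingTheory.FormalGroups.BudCocycle
import HarnessLib

/-!
# Formal `𝒪`-module laws lift along surjections of `𝒪`-algebras ([Drinfeld 1974] §1 Prop. 1.4 ⇒ smoothness of `Λ_𝒪`;
# [Hazewinkel 1978] §21.4 universality of `F_S`)

Topic `Literature/RingTheory/FormalGroups`; namespace `Literature.RingTheory.FormalGroups`.  THEOREMS + two plumbing definitions
(`UnivOModule.lawOf`, the base change of the universal law along `S_j ↦ w_j`; `UnivOModule.liftSeq`, the inductively corrected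
values); no named fact, no instance, no notation, no `sorry`.  Cell `hodgecm-mathlib`, P6 «MOD programme» ROW 4B, letter L4B.3c𝒪
(`stub_L4B3cO` of `Cruxes/HLiu418/Lines/F0_P6d_LubinTateFormalModuli.lean`), road «universal law by the functional equation
lemma» (desk F0P6d-plan, hand F0P6-p04), consuming the c𝒪-B road's ★ Drinfeld-cocycle and bud files (hand F0P6-p05).

MAIN THEOREM `FormalOModuleLaw.exists_map_eq`.  Let `𝒪` be a discrete valuation ring with finite residue field of characteristic
`p`, `π : A′ → A` a SURJECTIVE map of commutative `𝒪`-algebras, and `M` a formal `𝒪`-module law over `A` (★ `FormalOModuleLaw`).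
Then there is a formal `𝒪`-module law `M′` over `A′` with `π_* M′ = M` (law AND action).  No hypothesis on `p` in `A′`,
no completeness of `𝒪`.

PROOF (universality of Hazewinkel's `F_S` over `𝒪[S]`, [Hazewinkel1978] §21.4, proved here in Drinfeld's form).  With `ϖ` a
uniformizer and `q = #k`, ★ `univLaw ϖ q` is a formal `𝒪`-module law over `𝒪[S₂,S₃,…]`; for values `w : ℕ → A′` let
`N_w = (π ∘ ev_w)_* F_S`.  If `N_w ≡ M (mod deg m)` (`m ≥ 2`; for `m = 2` any `w` works) then the degree-`m` differences form a
Drinfeld cocycle over `A` (★ variation lemma `FormalOModuleBudVariation` + ★ `isBudRelation_of_coeff_var` + ★ Lazard's lemma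
`IsBudRelation.exists_isDrinfeldCocycle`), hence (★ `exists_eq_smul_direction`, Drinfeld's «`Λ̃_𝒪^m ≅ 𝒪`») a multiple
`d • (−d_m, e_m)` of the `S_m`-direction of `F_S`; changing `w_m` by a preimage of `−d` (★ `le_order_map_law_sub`,
`le_order_map_act_sub`) makes `N_w ≡ M (mod deg m+1)` without touching degrees `< m`.  The values stabilise; the limiting `w_∞`
gives `N_{w_∞}` over `A′` with `π_* N_{w_∞} = M`.

## References
* V. G. Drinfeld, *Elliptic modules*, Math. USSR-Sb. 23 (1974), §1 Prop. 1.4 («`Λ_𝒪 ≅ 𝒪[g₁, g₂, …]`», hence formal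
  `𝒪`-modules lift). [Drinfeld1974]
* M. Hazewinkel, *Formal Groups and Applications* (1978), §21.4 (the universal formal `A`-module `F^A_S`), §2.2. [Hazewinkel1978]
-/

noncomputable section

open scoped Classical

namespace Literature.RingTheory.FormalGroups

universe u v

namespace UnivOModule

open MvPowerSeries Literature.NumberTheory.GaloisRepresentations.LubinTate IsLocalRing Finset Finsupp

variable {𝒪 : Type u} [CommRing 𝒪]

/-! ## §1 Two formal `𝒪`-module laws agreeing modulo degree `m` differ by a Drinfeld cocycle -/

section Cocycle

variable {B : Type v} [CommRing B] [Algebra 𝒪 B]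

/-- A univariate series `θ` of order `≥ m` is `θ_m X^m` modulo degree `m+1`. [cite: Lazard1955, §I Lemme 1] -/
theorem le_order_sub_C_mul_X_pow {m : ℕ} {θ : PowerSeries B} (hθ : (m : ℕ∞) ≤ MvPowerSeries.order θ) :
    ((m + 1 : ℕ) : ℕ∞) ≤ MvPowerSeries.order (θ - PowerSeries.C (PowerSeries.coeff m θ) * PowerSeries.X ^ m : PowerSeries B) := by
  apply natCast_le_order_of_coeff_eq_zero
  intro i hi
  rw [map_sub, PowerSeries.coeff_C_mul, PowerSeries.coeff_X_pow]
  rcases (Nat.lt_succ_iff.mp hi).lt_or_eq with h | h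
  · rw [if_neg h.ne, mul_zero, sub_zero]
    have := (natCast_le_order_iff.mp hθ) (Finsupp.single () i) (by simpa using h)
    rwa [PowerSeries.coeff_def (s := Finsupp.single () i) (Finsupp.single_eq_same)]
  · rw [h, if_pos rfl, mul_one, sub_self]

/-- **Two formal `𝒪`-module laws that agree modulo degree `m ≥ 2` differ, in degree `m`, by a Drinfeld cocycle**: the degree-`m`
part of `N.F − M.F` is `c · C_m(X₀,X₁)` and `δ(a) = [X^m](N.act a − M.act a)` with `IsDrinfeldCocycle m c δ` (variation lemma +
Lazard's symmetric 2-cocycle lemma, all ★). [cite: Drinfeld1974, §1 Prop. 1.4 (proof)] [cite: Lazard1955, §II Lemme 2–3] -/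
theorem exists_isDrinfeldCocycle_of_agree (M N : FormalOModuleLaw 𝒪 B) {m : ℕ} (hm : 2 ≤ m)
    (hF : (m : ℕ∞) ≤ (N.toFormalGroup.toPowerSeries - M.toFormalGroup.toPowerSeries).order)
    (hρ : ∀ a, (m : ℕ∞) ≤ MvPowerSeries.order ((N.act a).toPowerSeries - (M.act a).toPowerSeries : PowerSeries B)) :
    ∃ c : B, (∀ j, degCoeff m (N.toFormalGroup.toPowerSeries - M.toFormalGroup.toPowerSeries) j = cocycleCoeff m j • c) ∧
      IsDrinfeldCocycle m c (fun a => PowerSeries.coeff m ((N.act a).toPowerSeries - (M.act a).toPowerSeries)) := by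
  set F := M.toFormalGroup.toPowerSeries with hFdef
  set Γ := N.toFormalGroup.toPowerSeries - M.toFormalGroup.toPowerSeries with hΓdef
  set φ : 𝒪 → PowerSeries B := fun a => (M.act a).toPowerSeries with hφdef
  set θ : 𝒪 → PowerSeries B := fun a => (N.act a).toPowerSeries - (M.act a).toPowerSeries with hθdef
  have bM := FormalOModuleLaw.isOModuleBud M m
  have bN := FormalOModuleLaw.isOModuleBud N m
  have hNF : N.toFormalGroup.toPowerSeries = F + Γ := by rw [hΓdef, hFdef]; abel
  have hNρ : ∀ a, (N.act a).toPowerSeries = φ a + θ a := fun a => by simp [hφdef, hθdef]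
  have hm1 : ((m + 1 : ℕ) : ℕ∞) ≤ ((m + 1 : ℕ) : ℕ∞) := le_rfl
  -- linear terms of the action
  have hφlin : ∀ a, ((2 : ℕ) : ℕ∞) ≤ MvPowerSeries.order (φ a - algebraMap 𝒪 B a • PowerSeries.X : PowerSeries B) := fun a => by
    apply natCast_le_order_of_coeff_eq_zero
    intro i hi
    have hi' : i = 0 ∨ i = 1 := by omega
    rcases hi' with rfl | rfl
    · rw [map_sub, PowerSeries.coeff_zero_eq_constantCoeff_apply, bM.constantCoeff_ρ, map_smul,
        PowerSeries.coeff_zero_eq_constantCoeff_apply, PowerSeries.constantCoeff_X, smul_zero, sub_zero]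
    · rw [map_sub, bM.coeff_one_ρ, map_smul, PowerSeries.coeff_one_X, smul_eq_mul, mul_one, sub_self]
  -- a series of order ≥ m+1 has vanishing coefficients in degree ≤ m
  have vanish : ∀ {σ : Type} (Δ : MvPowerSeries σ B) (d : σ →₀ ℕ), ((m + 1 : ℕ) : ℕ∞) ≤ Δ.order → d.degree = m →
      coeff d Δ = 0 := fun Δ d hΔ hd => (natCast_le_order_iff.mp hΔ) d (by omega)
  -- the five vanishing statements
  have hA' : ((m + 1 : ℕ) : ℕ∞) ≤ (assocVar Γ).order := by
    have h := le_order_assocDefect_add_sub bM.constantCoeff_F bM.two_le_order_F hm hF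
    rw [← hNF] at h
    have e : assocVar Γ = assocDefect N.toFormalGroup.toPowerSeries - assocDefect F -
        (assocDefect N.toFormalGroup.toPowerSeries - assocDefect F - assocVar Γ) := by ring
    rw [e]
    exact natCast_le_order_sub (natCast_le_order_sub bN.assoc bM.assoc) h
  have hC' : ((m + 1 : ℕ) : ℕ∞) ≤ (commDefect Γ).order := by
    have e : commDefect Γ = commDefect N.toFormalGroup.toPowerSeries - commDefect F := by
      rw [hNF, commDefect_add]; ring
    rw [e]
    exact natCast_le_order_sub bN.comm bM.comm
  have hH' : ∀ a, ((m + 1 : ℕ) : ℕ∞) ≤ (homVar (algebraMap 𝒪 B a) Γ (θ a)).order := fun a => by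
    have h := le_order_homDefect_add_sub bM.constantCoeff_F bM.two_le_order_F (bM.constantCoeff_ρ a) (hφlin a) hm hF (hρ a)
    rw [← hNF, ← hNρ] at h
    have e : homVar (algebraMap 𝒪 B a) Γ (θ a) = homDefect N.toFormalGroup.toPowerSeries (N.act a).toPowerSeries -
        homDefect F (φ a) - (homDefect N.toFormalGroup.toPowerSeries (N.act a).toPowerSeries - homDefect F (φ a) -
          homVar (algebraMap 𝒪 B a) Γ (θ a)) := by ring
    rw [e]
    exact natCast_le_order_sub (natCast_le_order_sub (bN.hom a) (bM.hom a)) h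
  have hAdd' : ∀ a b, ((m + 1 : ℕ) : ℕ∞) ≤ MvPowerSeries.order
      (addVar (algebraMap 𝒪 B a) (algebraMap 𝒪 B b) Γ (θ a) (θ b) (θ (a + b))) := fun a b => by
    have h := le_order_addDefect_add_sub (φab := φ (a + b)) (θab := θ (a + b)) bM.two_le_order_F (bM.constantCoeff_ρ a)
      (bM.constantCoeff_ρ b) (hφlin a) (hφlin b) hm hF (hρ a) (hρ b)
    rw [← hNF, ← hNρ, ← hNρ, ← hNρ] at h
    have e : addVar (algebraMap 𝒪 B a) (algebraMap 𝒪 B b) Γ (θ a) (θ b) (θ (a + b)) =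
        addDefect N.toFormalGroup.toPowerSeries (N.act a).toPowerSeries (N.act b).toPowerSeries (N.act (a + b)).toPowerSeries -
        addDefect F (φ a) (φ b) (φ (a + b)) - (addDefect N.toFormalGroup.toPowerSeries (N.act a).toPowerSeries
          (N.act b).toPowerSeries (N.act (a + b)).toPowerSeries - addDefect F (φ a) (φ b) (φ (a + b)) -
          addVar (algebraMap 𝒪 B a) (algebraMap 𝒪 B b) Γ (θ a) (θ b) (θ (a + b))) := by ring
    rw [e]
    exact natCast_le_order_sub (natCast_le_order_sub (bN.add a b) (bM.add a b)) h
  have hMul' : ∀ a b, ((m + 1 : ℕ) : ℕ∞) ≤ MvPowerSeries.order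
      (mulVar (algebraMap 𝒪 B a) (algebraMap 𝒪 B b) (θ a) (θ b) (θ (a * b))) := fun a b => by
    have h := le_order_mulDefect_add_sub (φa := φ a) (φab := φ (a * b)) (θab := θ (a * b)) (bM.constantCoeff_ρ b) (hφlin a)
      (hφlin b) hm (hρ a) (hρ b)
    rw [← hNρ, ← hNρ, ← hNρ] at h
    have e : mulVar (algebraMap 𝒪 B a) (algebraMap 𝒪 B b) (θ a) (θ b) (θ (a * b)) =
        mulDefect (N.act a).toPowerSeries (N.act b).toPowerSeries (N.act (a * b)).toPowerSeries -
        mulDefect (φ a) (φ b) (φ (a * b)) - (mulDefect (N.act a).toPowerSeries (N.act b).toPowerSeries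
          (N.act (a * b)).toPowerSeries - mulDefect (φ a) (φ b) (φ (a * b)) -
          mulVar (algebraMap 𝒪 B a) (algebraMap 𝒪 B b) (θ a) (θ b) (θ (a * b))) := by ring
    rw [e]
    exact natCast_le_order_sub (natCast_le_order_sub (bN.mul a b) (bM.mul a b)) h
  -- the relations, then Lazard
  have hrel := isBudRelation_of_coeff_var (𝒪 := 𝒪) hF hρ (LinearMap.id : B →ₗ[𝒪] B)
    (fun i j k h => vanish _ _ hA' (by rw [map_add, map_add, degree_single, degree_single, degree_single]; omega))
    (fun j hj => vanish _ _ hC' (by rw [map_add, degree_single, degree_single]; omega))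
    (fun a j hj => vanish _ _ (hH' a) (by rw [map_add, degree_single, degree_single]; omega))
    (fun a b => by
      have := vanish (σ := Unit) _ (Finsupp.single () m) (hAdd' a b) (by simp)
      rwa [PowerSeries.coeff_def (s := Finsupp.single () m) (Finsupp.single_eq_same)])
    (fun a b => by
      have := vanish (σ := Unit) _ (Finsupp.single () m) (hMul' a b) (by simp)
      rwa [PowerSeries.coeff_def (s := Finsupp.single () m) (Finsupp.single_eq_same)])
  simp only [LinearMap.id_apply] at hrel
  exact hrel.exists_isDrinfeldCocycle hm

/-- The degree-`m` part of a two-variable series of order `≥ m` whose coefficients are `c_{m,j} · c` is `c · C_m(X₀,X₁)` modulo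
degree `m+1`. [cite: Lazard1955, §II Lemme 3] -/
theorem le_order_sub_C_mul_cocyclePolyEval {m : ℕ} {Γ : MvPowerSeries (Fin 2) B} (hΓ : (m : ℕ∞) ≤ Γ.order) {c : B}
    (hc : ∀ j, degCoeff m Γ j = cocycleCoeff m j • c) :
    ((m + 1 : ℕ) : ℕ∞) ≤ (Γ - C c * cocyclePolyEval (MvPowerSeries (Fin 2) B) m (X 0) (X 1)).order := by
  have h := le_order_sub_homog hΓ
  have e : C c * cocyclePolyEval (MvPowerSeries (Fin 2) B) m (X 0) (X 1) =
      ∑ s ∈ range (m + 1), coeff (single 0 s + single 1 (m - s)) Γ • ((X 0) ^ s * (X 1) ^ (m - s)) := by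
    rw [cocyclePolyEval, Finset.mul_sum]
    refine Finset.sum_congr rfl fun s hs => ?_
    rw [Finset.mem_range] at hs
    rw [← degCoeff_of_le Γ (by omega : s ≤ m), hc s, MvPowerSeries.smul_eq_C_mul, map_nsmul, nsmul_eq_mul]
    ring
  rw [e]
  exact h

end Cocycle

/-! ## §2 The universal law evaluated at values `w : ℕ → A′`, and the correction step -/

section Step

variable [IsDomain 𝒪] [IsDiscreteValuationRing 𝒪] (p : ℕ) [hp : Fact p.Prime] [CharP (ResidueField 𝒪) p]
  [Finite (ResidueField 𝒪)] {ϖ : 𝒪} (hϖ : Irreducible ϖ)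
  {A : Type v} {A' : Type v} [CommRing A] [CommRing A'] [Algebra 𝒪 A] [Algebra 𝒪 A'] (πA : A' →ₐ[𝒪] A)

/-- `N_w = (π ∘ ev_w)_* F_S`: the universal law pushed to `A` along `S_j ↦ π(w_j)`. [cite: Hazewinkel1978, §21.4] -/
def lawOf (w : ℕ → A') : FormalOModuleLaw 𝒪 A :=
  (univLaw ϖ (Nat.card (ResidueField 𝒪)) (isLTRing_of_isDiscreteValuationRing p hϖ).1
    (isLTRing_of_isDiscreteValuationRing p hϖ).2).map (πA.comp (MvPolynomial.aeval w))

variable {p hϖ πA}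

/-- The law of `N_w`. [cite: Hazewinkel1978, §21.4] -/
theorem lawOf_toPowerSeries (w : ℕ → A') : (lawOf p hϖ πA w).toFormalGroup.toPowerSeries =
    MvPowerSeries.map (πA.comp (MvPolynomial.aeval w) : MvPolynomial ℕ 𝒪 →+* A)
      (lawInt ϖ (Nat.card (ResidueField 𝒪)) (isLTRing_of_isDiscreteValuationRing p hϖ).1
        (isLTRing_of_isDiscreteValuationRing p hϖ).2) := rfl

/-- The action of `N_w`. [cite: Hazewinkel1978, §21.4] -/
theorem lawOf_act (w : ℕ → A') (a : 𝒪) : ((lawOf p hϖ πA w).act a).toPowerSeries =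
    PowerSeries.map (πA.comp (MvPolynomial.aeval w) : MvPolynomial ℕ 𝒪 →+* A)
      (actInt ϖ (Nat.card (ResidueField 𝒪)) (isLTRing_of_isDiscreteValuationRing p hϖ).1
        (isLTRing_of_isDiscreteValuationRing p hϖ).2 a) := rfl

omit [IsDomain 𝒪] [IsDiscreteValuationRing 𝒪] [Finite (ResidueField 𝒪)] in
/-- Maps `ev_w`, `ev_{w'}` agreeing below `m` when `w`, `w'` do. [folklore] -/
private theorem aeval_agree {m : ℕ} {w w' : ℕ → A'} (h : ∀ j < m, w j = w' j) :
    ∀ j < m, (πA.comp (MvPolynomial.aeval w)) (MvPolynomial.X j) = (πA.comp (MvPolynomial.aeval w')) (MvPolynomial.X j) := by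
  intro j hj
  rw [AlgHom.comp_apply, AlgHom.comp_apply, MvPolynomial.aeval_X, MvPolynomial.aeval_X, h j hj]

/-- **Values agreeing below `m` give laws agreeing modulo degree `m`.** [cite: Hazewinkel1978, §21.4] -/
theorem le_order_lawOf_sub (m : ℕ) (hm : 2 ≤ m) {w w' : ℕ → A'} (h : ∀ j < m, w j = w' j) :
    (m : ℕ∞) ≤ ((lawOf p hϖ πA w').toFormalGroup.toPowerSeries - (lawOf p hϖ πA w).toFormalGroup.toPowerSeries).order ∧
      ∀ a, (m : ℕ∞) ≤ MvPowerSeries.order (((lawOf p hϖ πA w').act a).toPowerSeries -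
        ((lawOf p hϖ πA w).act a).toPowerSeries : PowerSeries A) :=
  ⟨le_order_map_law_sub' (isLTRing_of_isDiscreteValuationRing p hϖ).1 (isLTRing_of_isDiscreteValuationRing p hϖ).2 hm
      (aeval_agree (πA := πA) h),
    fun a => le_order_map_act_sub' (isLTRing_of_isDiscreteValuationRing p hϖ).1 (isLTRing_of_isDiscreteValuationRing p hϖ).2
      hm a (aeval_agree (πA := πA) h)⟩

/-- **The correction step.**  If `N_w ≡ M (mod deg m)` (`m ≥ 2`) then for some `t ∈ A′`, with `w′ = w + t·[· = m]`,
`N_{w′} ≡ M (mod deg m+1)`. (The degree-`m` difference is a Drinfeld cocycle, hence `d • (−d_m, e_m)`; take `π(t) = −d`.)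
[cite: Drinfeld1974, §1 Prop. 1.4] [cite: Hazewinkel1978, §21.4] -/
theorem exists_lawOf_update (hπ : Function.Surjective πA) (M : FormalOModuleLaw 𝒪 A) {m : ℕ} (hm : 2 ≤ m) (w : ℕ → A')
    (hF : (m : ℕ∞) ≤ ((lawOf p hϖ πA w).toFormalGroup.toPowerSeries - M.toFormalGroup.toPowerSeries).order)
    (hρ : ∀ a, (m : ℕ∞) ≤ MvPowerSeries.order (((lawOf p hϖ πA w).act a).toPowerSeries - (M.act a).toPowerSeries :
      PowerSeries A)) :
    ∃ t : A', ((m + 1 : ℕ) : ℕ∞) ≤ ((lawOf p hϖ πA (Function.update w m (w m + t))).toFormalGroup.toPowerSeries -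
        M.toFormalGroup.toPowerSeries).order ∧
      ∀ a, ((m + 1 : ℕ) : ℕ∞) ≤ MvPowerSeries.order (((lawOf p hϖ πA (Function.update w m (w m + t))).act a).toPowerSeries -
        (M.act a).toPowerSeries : PowerSeries A) := by
  set q := Nat.card (ResidueField 𝒪) with hqdef
  have hA : IsLTRing ϖ q := (isLTRing_of_isDiscreteValuationRing p hϖ).1
  have hq : 2 ≤ q := (isLTRing_of_isDiscreteValuationRing p hϖ).2
  -- the Drinfeld cocycle of the difference and its direction
  obtain ⟨c, hc, hcoc⟩ := exists_isDrinfeldCocycle_of_agree M (lawOf p hϖ πA w) hm hF hρ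
  obtain ⟨d, hcd, hδd⟩ := exists_eq_smul_direction p hϖ hA hq hm hcoc
  obtain ⟨t, ht⟩ := hπ (-d)
  refine ⟨t, ?_, fun a => ?_⟩
  · -- the law
    set w' := Function.update w m (w m + t) with hw'
    have hagree : ∀ j < m, (πA.comp (MvPolynomial.aeval w)) (MvPolynomial.X j) =
        (πA.comp (MvPolynomial.aeval w')) (MvPolynomial.X j) :=
      aeval_agree (fun j hj => by rw [hw', Function.update_of_ne (by omega)])
    have hdiff : (πA.comp (MvPolynomial.aeval w')) (MvPolynomial.X m) - (πA.comp (MvPolynomial.aeval w)) (MvPolynomial.X m) = -d := by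
      rw [AlgHom.comp_apply, AlgHom.comp_apply, MvPolynomial.aeval_X, MvPolynomial.aeval_X, hw', Function.update_self,
        map_add, add_sub_cancel_left, ht]
    have h1 := le_order_map_law_sub hA hq hm hagree
    rw [hdiff] at h1
    have h2 := le_order_sub_C_mul_cocyclePolyEval hF hc
    -- `c = (−d_m) • d`
    have hcd' : c = -(algebraMap 𝒪 A (dirCoeff ϖ q hA m) * d) := by rw [hcd, neg_smul, Algebra.smul_def]
    have e : (lawOf p hϖ πA w').toFormalGroup.toPowerSeries - M.toFormalGroup.toPowerSeries =
        (MvPowerSeries.map (πA.comp (MvPolynomial.aeval w') : MvPolynomial ℕ 𝒪 →+* A) (lawInt ϖ q hA hq) -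
          MvPowerSeries.map (πA.comp (MvPolynomial.aeval w) : MvPolynomial ℕ 𝒪 →+* A) (lawInt ϖ q hA hq) +
          C (-d * algebraMap 𝒪 A (dirCoeff ϖ q hA m)) * cocyclePolyEval (MvPowerSeries (Fin 2) A) m (X 0) (X 1)) +
        ((lawOf p hϖ πA w).toFormalGroup.toPowerSeries - M.toFormalGroup.toPowerSeries -
          C c * cocyclePolyEval (MvPowerSeries (Fin 2) A) m (X 0) (X 1)) := by
      rw [lawOf_toPowerSeries, lawOf_toPowerSeries, hcd', map_neg, map_mul, map_neg, map_mul]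
      ring
    rw [e]
    exact natCast_le_order_add h1 h2
  · -- the action
    set w' := Function.update w m (w m + t) with hw'
    have hagree : ∀ j < m, (πA.comp (MvPolynomial.aeval w)) (MvPolynomial.X j) =
        (πA.comp (MvPolynomial.aeval w')) (MvPolynomial.X j) :=
      aeval_agree (fun j hj => by rw [hw', Function.update_of_ne (by omega)])
    have hdiff : (πA.comp (MvPolynomial.aeval w')) (MvPolynomial.X m) - (πA.comp (MvPolynomial.aeval w)) (MvPolynomial.X m) = -d := by
      rw [AlgHom.comp_apply, AlgHom.comp_apply, MvPolynomial.aeval_X, MvPolynomial.aeval_X, hw', Function.update_self,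
        map_add, add_sub_cancel_left, ht]
    have h1 := le_order_map_act_sub hA hq hm a (actDir ϖ q hA m a) (actDir_spec (π := ϖ) hA m a).2 hagree
    rw [hdiff] at h1
    have h2 := le_order_sub_C_mul_X_pow (hρ a)
    have hδ : PowerSeries.coeff m (((lawOf p hϖ πA w).act a).toPowerSeries - (M.act a).toPowerSeries) =
        algebraMap 𝒪 A (actDir ϖ q hA m a) * d := by rw [hδd a, Algebra.smul_def]
    have e : (((lawOf p hϖ πA w').act a).toPowerSeries - (M.act a).toPowerSeries : PowerSeries A) =
        (PowerSeries.map (πA.comp (MvPolynomial.aeval w') : MvPolynomial ℕ 𝒪 →+* A) (actInt ϖ q hA hq a) -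
          PowerSeries.map (πA.comp (MvPolynomial.aeval w) : MvPolynomial ℕ 𝒪 →+* A) (actInt ϖ q hA hq a) -
          PowerSeries.C (-d * algebraMap 𝒪 A (actDir ϖ q hA m a)) * PowerSeries.X ^ m) +
        (((lawOf p hϖ πA w).act a).toPowerSeries - (M.act a).toPowerSeries -
          PowerSeries.C (PowerSeries.coeff m (((lawOf p hϖ πA w).act a).toPowerSeries - (M.act a).toPowerSeries)) *
            PowerSeries.X ^ m) := by
      rw [hδ, lawOf_act, lawOf_act, map_mul, map_neg, map_mul]
      ring
    rw [e]
    exact natCast_le_order_add h1 h2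

/-- **The base case**: every `N_w` agrees with every `M` modulo degree `2` (`F ≡ X₀ + X₁`, `[a] ≡ aX`).
[cite: Hazewinkel1978, §21.1 Def. (21.1.1)] -/
theorem two_le_order_lawOf_sub (M : FormalOModuleLaw 𝒪 A) (w : ℕ → A') :
    ((2 : ℕ) : ℕ∞) ≤ ((lawOf p hϖ πA w).toFormalGroup.toPowerSeries - M.toFormalGroup.toPowerSeries).order ∧
      ∀ a, ((2 : ℕ) : ℕ∞) ≤ MvPowerSeries.order (((lawOf p hϖ πA w).act a).toPowerSeries - (M.act a).toPowerSeries :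
        PowerSeries A) := by
  have bM := FormalOModuleLaw.isOModuleBud M 1
  have bN := FormalOModuleLaw.isOModuleBud (lawOf p hϖ πA w) 1
  refine ⟨?_, fun a => ?_⟩
  · have e : (lawOf p hϖ πA w).toFormalGroup.toPowerSeries - M.toFormalGroup.toPowerSeries =
        ((lawOf p hϖ πA w).toFormalGroup.toPowerSeries - X 0 - X 1) - (M.toFormalGroup.toPowerSeries - X 0 - X 1) := by ring
    rw [e]
    exact natCast_le_order_sub bN.two_le_order_F bM.two_le_order_F
  · apply natCast_le_order_of_coeff_eq_zero
    intro i hi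
    have hi' : i = 0 ∨ i = 1 := by omega
    rcases hi' with rfl | rfl
    · rw [map_sub, PowerSeries.coeff_zero_eq_constantCoeff_apply, bN.constantCoeff_ρ,
        PowerSeries.coeff_zero_eq_constantCoeff_apply, bM.constantCoeff_ρ, sub_self]
    · rw [map_sub, bN.coeff_one_ρ, bM.coeff_one_ρ, sub_self]

end Step

/-! ## §3 The limit: lifting -/

section Lift

variable [IsDomain 𝒪] [IsDiscreteValuationRing 𝒪] (p : ℕ) [hp : Fact p.Prime] [CharP (ResidueField 𝒪) p]
  [Finite (ResidueField 𝒪)] {ϖ : 𝒪} (hϖ : Irreducible ϖ)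
  {A : Type v} {A' : Type v} [CommRing A] [CommRing A'] [Algebra 𝒪 A] [Algebra 𝒪 A'] (πA : A' →ₐ[𝒪] A)
  (hπ : Function.Surjective πA) (M : FormalOModuleLaw 𝒪 A)

/-- The property "`N_w ≡ M (mod deg k)`" (law and action). [cite: Hazewinkel1978, §21.4] -/
private def Agrees (k : ℕ) (w : ℕ → A') : Prop :=
  (k : ℕ∞) ≤ ((lawOf p hϖ πA w).toFormalGroup.toPowerSeries - M.toFormalGroup.toPowerSeries).order ∧
    ∀ a, (k : ℕ∞) ≤ MvPowerSeries.order (((lawOf p hϖ πA w).act a).toPowerSeries - (M.act a).toPowerSeries : PowerSeries A)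

/-- **The inductively corrected values** `w^{(k)}` (`N_{w^{(k)}} ≡ M (mod deg k+2)`), packaged with the invariant.
[cite: Drinfeld1974, §1 Prop. 1.4] -/
def liftSeq : (k : ℕ) → {w : ℕ → A' // Agrees p hϖ πA M (k + 2) w}
  | 0 => ⟨fun _ => 0, two_le_order_lawOf_sub M _⟩
  | k + 1 =>
    let prev := liftSeq k
    let t := (exists_lawOf_update (p := p) (hϖ := hϖ) hπ M (by omega : 2 ≤ k + 2) prev.1 prev.2.1 prev.2.2).choose
    ⟨Function.update prev.1 (k + 2) (prev.1 (k + 2) + t),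
      (exists_lawOf_update (p := p) (hϖ := hϖ) hπ M (by omega : 2 ≤ k + 2) prev.1 prev.2.1 prev.2.2).choose_spec⟩

variable {p hϖ πA hπ M}

/-- The recursion step of `liftSeq` only changes the value at `k + 2`. [cite: Drinfeld1974, §1 Prop. 1.4] -/
theorem liftSeq_succ_apply_of_ne (k j : ℕ) (hj : j ≠ k + 2) :
    (liftSeq p hϖ πA hπ M (k + 1)).1 j = (liftSeq p hϖ πA hπ M k).1 j := by
  rw [liftSeq]
  exact Function.update_of_ne hj _ _

/-- Stability: the value at `j` does not change after stage `k` once `j < k + 2`. [cite: Drinfeld1974, §1 Prop. 1.4] -/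
theorem liftSeq_apply_eq_of_le {k k' : ℕ} (hkk' : k ≤ k') {j : ℕ} (hj : j < k + 2) :
    (liftSeq p hϖ πA hπ M k').1 j = (liftSeq p hϖ πA hπ M k).1 j := by
  induction k', hkk' using Nat.le_induction with
  | base => rfl
  | succ k' hle ih => rw [liftSeq_succ_apply_of_ne _ _ (by omega), ih]

/-- The limiting values `w_∞(j) = w^{(j)}(j)`. [cite: Drinfeld1974, §1 Prop. 1.4] -/
theorem liftSeq_limit_agree (k : ℕ) : ∀ j < k + 2, (liftSeq p hϖ πA hπ M k).1 j = (liftSeq p hϖ πA hπ M j).1 j := by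
  intro j hj
  rcases le_or_gt j k with h | h
  · exact liftSeq_apply_eq_of_le h (by omega)
  · exact (liftSeq_apply_eq_of_le h.le hj).symm

end Lift

section Main

variable [IsDomain 𝒪] [IsDiscreteValuationRing 𝒪]

/-- **Formal `𝒪`-module laws lift along surjections** (`𝒪` a DVR with finite residue field of characteristic `p`; no other
hypothesis): for `π : A′ → A` a surjective `𝒪`-algebra map and `M` a formal `𝒪`-module law over `A` there is a formal
`𝒪`-module law `M′` over `A′` with `π_* M′ = M` — law and action.  ([Drinfeld1974]: `Λ_𝒪 ≅ 𝒪[g₁,g₂,…]` is a polynomial ring;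
here via the universality of Hazewinkel's `F_S` proved degree by degree.) [cite: Drinfeld1974, §1 Prop. 1.4] [cite: Hazewinkel1978, §21.4] -/
theorem exists_formalOModuleLaw_map_eq (p : ℕ) [Fact p.Prime] [CharP (ResidueField 𝒪) p] [Finite (ResidueField 𝒪)]
    {A : Type v} {A' : Type v} [CommRing A] [CommRing A'] [Algebra 𝒪 A] [Algebra 𝒪 A']
    (πA : A' →ₐ[𝒪] A) (hπ : Function.Surjective πA) (M : FormalOModuleLaw 𝒪 A) :
    ∃ M' : FormalOModuleLaw 𝒪 A', M'.toFormalGroup.map πA.toRingHom = M.toFormalGroup ∧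
      ∀ a, PowerSeries.map πA.toRingHom (M'.act a).toPowerSeries = (M.act a).toPowerSeries := by
  obtain ⟨ϖ, hϖ⟩ := IsDiscreteValuationRing.exists_irreducible 𝒪
  set q := Nat.card (ResidueField 𝒪) with hqdef
  have hA : IsLTRing ϖ q := (isLTRing_of_isDiscreteValuationRing p hϖ).1
  have hq : 2 ≤ q := (isLTRing_of_isDiscreteValuationRing p hϖ).2
  -- the limiting values and the law over `A'`
  set winf : ℕ → A' := fun j => (liftSeq p hϖ πA hπ M j).1 j with hwinf
  set U := univLaw ϖ q hA hq with hU
  refine ⟨U.map (MvPolynomial.aeval winf), ?_, fun a => ?_⟩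
  · -- the law: `π_* (ev_{w∞})_* F_S = N_{w∞}` agrees with `M` modulo every degree
    have hN : (U.map (MvPolynomial.aeval winf)).toFormalGroup.map πA.toRingHom = (lawOf p hϖ πA winf).toFormalGroup := by
      apply FormalGroup.ext
      rw [FormalGroup.map_toPowerSeries, lawOf_toPowerSeries, FormalOModuleLaw.map_toFormalGroup, FormalGroup.map_toPowerSeries,
        univLaw_toPowerSeries, MvPowerSeries.map_map]
      rfl
    rw [hN]
    apply FormalGroup.ext
    rw [← sub_eq_zero]
    apply MvPowerSeries.ext
    intro d
    rw [coeff_zero]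
    have hk := (liftSeq p hϖ πA hπ M d.degree).2.1
    have hagree := (le_order_lawOf_sub (p := p) (hϖ := hϖ) (πA := πA) (d.degree + 2) (by omega)
      (liftSeq_limit_agree (p := p) (hϖ := hϖ) (πA := πA) (hπ := hπ) (M := M) d.degree)).1
    have h := natCast_le_order_add hagree hk
    rw [sub_add_sub_cancel] at h
    exact (natCast_le_order_iff.mp h) d (by omega)
  · have hN : PowerSeries.map πA.toRingHom ((U.map (MvPolynomial.aeval winf)).act a).toPowerSeries =
        ((lawOf p hϖ πA winf).act a).toPowerSeries := by
      rw [lawOf_act, FormalOModuleLaw.map_act, FormalGroupHom.map_toPowerSeries, univLaw_act,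
        ← RingHom.comp_apply (PowerSeries.map πA.toRingHom), ← PowerSeries.map_comp]
      rfl
    rw [hN, ← sub_eq_zero]
    apply PowerSeries.ext
    intro n
    rw [map_zero]
    have hk := (liftSeq p hϖ πA hπ M n).2.2 a
    have hagree := (le_order_lawOf_sub (p := p) (hϖ := hϖ) (πA := πA) (n + 2) (by omega)
      (liftSeq_limit_agree (p := p) (hϖ := hϖ) (πA := πA) (hπ := hπ) (M := M) n)).2 a
    have h := natCast_le_order_add hagree hk
    rw [sub_add_sub_cancel] at h
    have := (natCast_le_order_iff.mp h) (Finsupp.single () n) (by simp)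
    rwa [PowerSeries.coeff_def (s := Finsupp.single () n) (Finsupp.single_eq_same)]

end Main

end UnivOModule

/-- **Formal `𝒪`-module laws lift along surjections of `𝒪`-algebras** — `𝒪` a discrete valuation ring with finite residue
field of characteristic `p`, `π : A′ ↠ A` a surjective `𝒪`-algebra map, `M` a ★ `FormalOModuleLaw 𝒪 A`: there is
`M′ : FormalOModuleLaw 𝒪 A′` with `π_* M′.F = M.F` and `π_* [a]_{M′} = [a]_M` for all `a`.  (Drinfeld: `Λ_𝒪` is a polynomial
ring; proved via Hazewinkel's universal law `F_S` and Drinfeld's cocycle lemma.) [cite: Drinfeld1974, §1 Prop. 1.4]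
[cite: Hazewinkel1978, §21.4] -/
theorem FormalOModuleLaw.exists_map_eq {𝒪 : Type u} [CommRing 𝒪] [IsDomain 𝒪] [IsDiscreteValuationRing 𝒪] (p : ℕ)
    [Fact p.Prime] [CharP (IsLocalRing.ResidueField 𝒪) p] [Finite (IsLocalRing.ResidueField 𝒪)]
    {A : Type v} {A' : Type v} [CommRing A] [CommRing A'] [Algebra 𝒪 A] [Algebra 𝒪 A'] (πA : A' →ₐ[𝒪] A)
    (hπ : Function.Surjective πA) (M : FormalOModuleLaw 𝒪 A) :
    ∃ M' : FormalOModuleLaw 𝒪 A', M'.toFormalGroup.map πA.toRingHom = M.toFormalGroup ∧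
      ∀ a, PowerSeries.map πA.toRingHom (M'.act a).toPowerSeries = (M.act a).toPowerSeries :=
  UnivOModule.exists_formalOModuleLaw_map_eq p πA hπ M

end Literature.RingTheory.FormalGroups
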